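import Summits.FinalStateConjecture.FinalStateConjecture.Theorems.SwallowTheDatumUniversalWitnessFamilySheetLineReduction
import Summits.FinalStateConjecture.FinalStateConjecture.Theorems.SwallowTheDatumUniversalWitnessFamilyStubSocketBagOfPlugDataPlusFrom
import Summits.FinalStateConjecture.FinalStateConjecture.Theorems.SwallowTheDatumUniversalWitnessFamilyStubModelData
import Summits.FinalStateConjecture.FinalStateConjecture.Theorems.SwallowTheDatumUniversalWitnessFamilyStubSchwOutSite
import Summits.FinalStateConjecture.FinalStateConjecture.Theorems.SwallowTheDatumUniversalWitnessFamilyStubPlugDataPlusFromOf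
import Summits.FinalStateConjecture.FinalStateConjecture.Theorems.SwallowTheDatumUniversalWitnessFamilyStubCapEnd
import HarnessLib

/-!
# Crux `SwallowTheDatum.UniversalWitnessFamily` (stmt-FinalStateConjecture-10051), line `Sketch` (skeleton v7) —
# REDUCTION TO THE ROUTE ITEMS, THE PRINTED GLUING THEOREM AND ONE EXPLICIT STATEMENT (the bulk)

Continuation lead c2, 2026-08-16.  With WAVE 1 of line `Sketch` LANDED — `stub_socketBag_of_plugDataPlusFrom`
(`…StubSocketBagOfPlugDataPlusFrom.lean`), `stub_modelData` (`…StubModelData.lean`), `stub_schwOutSite` (`…StubSchwOutSite.lean`),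
`stub_plugDataPlusFrom_of` (`…StubPlugDataPlusFromOf.lean`), `stub_capEnd` (`…StubCapEnd.lean`) — the UNIVERSAL SOCKET BAG (the
d-free analytic hypothesis of the landed `universalWitnessFamily_of_farGluing_of_socketBag`) follows from the printed, vendored
Mao–Oh–Tao theorem `Literature.Geometry.Lorentzian.MaoOhTao.ObstructionFreeAnnularGluing` (arXiv:2308.13031, Thm 1.7 + Rem 1.9, taken
BY NAME — the result is CONDITIONAL on it) and ONE explicit-analysis statement, the Brill–Lindquist bulk with its `N + 2` Thm-1.7 sites
(`BulkAt`, vocabulary of `Theorems/SwallowTheDatumParametricKerrBurialEngine.lean`; quantifier in the repaired form `∃ μ'₀ > 0, ∀ μ' ≤ μ'₀`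
— the form `∀ μ' > 0` is false, the central in-field is not near flat for large `μ'`).  Since route rev 9 the far gluing is the route
item `FarAnnulusGluing` (stmt-15427), which IS the line's `stub_farGluing` with its vocabulary inlined.  Hence:

  `MGHDExists → SubdataDevelopmentsEmbed → FarAnnulusGluing → ObstructionFreeAnnularGluing → (bulk) → UniversalWitnessFamily`.

This displays exactly what an unconditional proof of the crux still owes: the three route items, the printed gluing theorem, and the
bulk.  CONDITIONAL; credits nothing by itself.
-/

-- `Summit.<Summit>.<Problem>` is the tree's mandated summit-side namespace (CONVENTIONS §2); for this
-- single-conjunct summit the two coincide, so the duplicate is deliberate.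
set_option linter.dupNamespace false

noncomputable section

namespace Summit.FinalStateConjecture.FinalStateConjecture.Theorems.SwallowTheDatum.UniversalWitnessFamily.SheetLine

open scoped Manifold ContDiff Topology InnerProductSpace
open Set Filter Function Literature.Geometry.Lorentzian
open Literature.Geometry.Lorentzian.MaoOhTao Literature.Geometry.Lorentzian.InitialDataSet
open Summit.FinalStateConjecture.FinalStateConjecture.Theses.SwallowTheDatum
  (UniversalWitnessFamily MGHDExists SubdataDevelopmentsEmbed FarAnnulusGluing)
open Summit.FinalStateConjecture.FinalStateConjecture.Theorems.SwallowTheDatum.ParametricKerrBurial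
  (IsSchwarzschildAnnulus VacuumOn IsIsotropicBeyond CapEndAt FlatVacuumDatum SchwDatum SchwOutSite BulkAt)

/-- **The universal socket bag from the printed gluing theorem and the bulk** (everything else landed): Thm 1.7 BY NAME, the cap
`stub_capEnd`, the model data `stub_modelData`, the Schwarzschild site `stub_schwOutSite` and the bulk give PlugData⁺ at every `(μ₀, M)`
(`stub_plugDataPlusFrom_of`); the radial stretch gives the canonical socket bag (`stub_socketBag_of_plugDataPlusFrom`).
[cite: MaoOhTao2023, Thm 1.7] -/
theorem socketBag_of_obstructionFreeAnnularGluing_of_bulkAt :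
    ObstructionFreeAnnularGluing →
    (∀ η : ℝ → ℝ, IsBump η → ∀ (εo μo M : ℝ), 0 < εo → 0 < μo → 0 < M →
      ∃ μ'₀ : ℝ, 0 < μ'₀ ∧ ∀ μ' : ℝ, 0 < μ' → μ' ≤ μ'₀ → BulkAt η εo μo M μ') →
    ∀ μ₀ : ℝ, 0 < μ₀ → ∃ μ : ℝ, 0 < μ ∧ μ ≤ μ₀ ∧
      ∃ (M : ℝ) (C : InitialDataSet (𝓡 3) E3), 4 < M ∧
        VacuumOn {y : E3 | 1 < ‖y‖} C ∧ IsSchwarzschildAnnulus C μ ∧ IsIsotropicBeyond M (M / 2) C :=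
  fun hMOT hBulk ↦
    stub_socketBag_of_plugDataPlusFrom
      (stub_plugDataPlusFrom_of hMOT stub_capEnd stub_modelData.1 stub_modelData.2 stub_schwOutSite hBulk)

/-- **The crux from the route items, the printed gluing theorem and the bulk**: `FarAnnulusGluing` (stmt-15427) is the line's far
gluing verbatim (the item inlines `SmoothSectionsOn`/`AgreeAt`/`IsExactSchwarzschildBeyond` definitionally), the socket bag comes from
`socketBag_of_obstructionFreeAnnularGluing_of_bulkAt`, and the composition is the landed
`universalWitnessFamily_of_farGluing_of_socketBag`. [cite: MaoOhTao2023, Thm 1.7] -/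
theorem universalWitnessFamily_of_items_of_obstructionFreeAnnularGluing_of_bulkAt :
    MGHDExists → SubdataDevelopmentsEmbed → FarAnnulusGluing → ObstructionFreeAnnularGluing →
    (∀ η : ℝ → ℝ, IsBump η → ∀ (εo μo M : ℝ), 0 < εo → 0 < μo → 0 < M →
      ∃ μ'₀ : ℝ, 0 < μ'₀ ∧ ∀ μ' : ℝ, 0 < μ' → μ' ≤ μ'₀ → BulkAt η εo μo M μ') →
    UniversalWitnessFamily :=
  fun hM hE hA hMOT hBulk ↦
    universalWitnessFamily_of_farGluing_of_socketBag hM hE hA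
      (socketBag_of_obstructionFreeAnnularGluing_of_bulkAt hMOT hBulk)

end Summit.FinalStateConjecture.FinalStateConjecture.Theorems.SwallowTheDatum.UniversalWitnessFamily.SheetLine

end
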